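import Literature.Topology.FourManifolds.CobordismAttachment
import HarnessLib

/-!
# Two attachments of one cobordism along boundary identifications that differ by the restriction of a homeomorphism of the piece are homeomorphic

Topic `Literature/Topology/FourManifolds` (vocabulary of `CobordismAttachment.lean`). Everything
here is PROVED (point-set topology); no definitions, no named facts.

Let `W` be a compact manifold with boundary (boundary datum `b`), `X` a cobordism from `M` to
`N`, and let `V = W ∪_ψ X`, `V′ = W ∪_{ψ′} X` be attachments of `X` to `W` along two boundary
identifications `ψ, ψ′ : ∂W ≅ M` (`Literature.Topology.FourManifolds.CobordismAttachment b X ψ V`,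
`… b X ψ′ V′`: smooth embeddings `jW`, `jX` of the pieces covering the result and meeting
exactly along `∂W ≡ M`). If the difference `ψ′⁻¹ ∘ ψ : ∂W → ∂W` is the restriction of a
self-HOMEOMORPHISM `F` of `W` (`F ∘ b.incl = b.incl ∘ ψ′⁻¹ ∘ ψ`), then **`F ∪ id_X` is a
homeomorphism `V ≃ₜ V′`** with `Φ ∘ jW = jW′ ∘ F`, `Φ ∘ jX = jX′`
(`CobordismAttachment.exists_homeomorph_apply_jW_eq`): it is well defined because both
attachments identify `jW (incl z)` with `jX (inl (ψ z))` (resp. `ψ′`) and nothing else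
(`exists_map_apply_jW_eq`), it is bijective with inverse `F⁻¹ ∪ id_X`, and it is continuous by
the closed-cover criterion (`continuous_of_comp`: the pieces `jW(W)`, `jX(X)` are compact and
`V` is Hausdorff). This is the topological half of Milnor's remark that `W ∪_h W′` is a well
defined space (Milnor (1965), §1, Thm. 1.4: the smooth structure is the issue, the space is the
pushout); no smoothness is claimed for `Φ` (across the seam it has none in general).

Use: `Literature/Barriers/SmoothPoincare4/ExoticContractibleCorkHomeomorphProofs.lean` — in
Akbulut–Ruberman's construction `V = W ∪_{id} X`, `V′ = W ∪_f X` from a cork `(W, f)`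
(Akbulut–Ruberman (2016), §§2–3), the cork diffeomorphism `f` extends BY DEFINITION to a
self-homeomorphism `F` of `W`, so `V′ ≃ₜ V` by `F ∪ id_X`
(`exists_homeomorph_of_apply_incl_eq`), without the appeal to Freedman's classification made
at this point of the printed proof of Thm. B.

## References

* J. Milnor, *Lectures on the h-cobordism theorem*, Princeton (1965), §1, Thm. 1.4.
  [MilnorHCobordism1965]
* S. Akbulut, D. Ruberman, *Absolutely exotic compact 4-manifolds*, Comment. Math. Helv. 91
  (2016) 1–19, §2 (the construction `V = W ∪_M X`, `V′`) and §3. [AkbulutRuberman2016]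
-/

noncomputable section

open scoped Manifold ContDiff Topology
open Function Set

namespace Literature.Topology.FourManifolds

namespace CobordismAttachment

universe u v w

variable {n : ℕ} {W : Type u} [TopologicalSpace W] [ChartedSpace (EuclideanHalfSpace (n + 1)) W]
  {M N : Type u} [TopologicalSpace M] [ChartedSpace (EuclideanSpace ℝ (Fin n)) M]
  [TopologicalSpace N] [ChartedSpace (EuclideanSpace ℝ (Fin n)) N]
  {b : BoundaryData (𝓡∂ (n + 1)) W (𝓡 n)} {X : Cobordism n M N}
  {ψ ψ' : b.carrier ≃ₘ⟮𝓡 n, 𝓡 n⟯ M}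
  {V : Type v} [TopologicalSpace V] [ChartedSpace (EuclideanHalfSpace (n + 1)) V]
  {V' : Type w} [TopologicalSpace V'] [ChartedSpace (EuclideanHalfSpace (n + 1)) V']

/-! ### Closed-cover criterion for maps out of an attachment -/

/-- **Closed-cover criterion**: a map out of `V = W ∪_ψ X` (`W` compact, `V` Hausdorff) is
continuous as soon as its composites with the embeddings `jW`, `jX` of the two (compact) pieces
are: the trace of a closed set on each piece is compact, so its image is closed, and the two
images cover the preimage. [folklore] -/
theorem continuous_of_comp [CompactSpace W] [T2Space V] (A : CobordismAttachment b X ψ V)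
    {Y : Type*} [TopologicalSpace Y] {Φ : V → Y} (hW : Continuous (Φ ∘ A.jW))
    (hX : Continuous (Φ ∘ A.jX)) : Continuous Φ := by
  rw [continuous_iff_isClosed]
  intro C hC
  have hcov : Φ ⁻¹' C = A.jW '' (A.jW ⁻¹' (Φ ⁻¹' C)) ∪ A.jX '' (A.jX ⁻¹' (Φ ⁻¹' C)) := by
    rw [image_preimage_eq_inter_range, image_preimage_eq_inter_range, ← inter_union_distrib_left,
      A.range_union, inter_univ]
  rw [hcov]
  exact ((hC.preimage hW).isCompact.image A.continuous_jW).isClosed.union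
    ((hC.preimage hX).isCompact.image A.continuous_jX).isClosed

/-! ### The map `F ∪ id_X` -/

/-- **`F ∪ id_X : W ∪_ψ X → W ∪_{ψ′} X` is well defined** for every self-map `F` of `W` with
`F (incl z) = incl (ψ′⁻¹ (ψ z))` on `∂W`: there is `Φ : V → V′` with `Φ ∘ jW = jW′ ∘ F` and
`Φ ∘ jX = jX′` (the two prescriptions agree on the seam, where `jW (incl z) = jX (inl (ψ z))` is
sent to `jW′ (incl (ψ′⁻¹ (ψ z))) = jX′ (inl (ψ z))`). [cite: MilnorHCobordism1965, §1, Thm. 1.4] -/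
theorem exists_map_apply_jW_eq (A : CobordismAttachment b X ψ V)
    (A' : CobordismAttachment b X ψ' V') (F : W → W)
    (hF : ∀ z, F (b.incl z) = b.incl (ψ'.symm (ψ z))) :
    ∃ Φ : V → V', (∀ w, Φ (A.jW w) = A'.jW (F w)) ∧ ∀ x, Φ (A.jX x) = A'.jX x := by
  classical
  refine ⟨fun p => if h : ∃ w, A.jW w = p then A'.jW (F h.choose)
      else A'.jX ((A.exists_jW_eq_or p).resolve_left h).choose, fun w => ?_, fun x => ?_⟩
  · have h : ∃ w', A.jW w' = A.jW w := ⟨w, rfl⟩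
    dsimp only
    rw [dif_pos h, A.injective_jW h.choose_spec]
  · by_cases h : ∃ w, A.jW w = A.jX x
    · dsimp only
      rw [dif_pos h]
      obtain ⟨z, hz, hx⟩ := (A.jW_eq_jX_iff _ _).1 h.choose_spec
      rw [hz, hF, A'.jW_incl, Diffeomorph.apply_symm_apply, ← hx]
    · dsimp only
      rw [dif_neg h, A.injective_jX ((A.exists_jW_eq_or _).resolve_left h).choose_spec]

/-- The boundary relation satisfied by the inverse homeomorphism: if `F (incl z) = incl (ψ′⁻¹ (ψ z))`
for all `z`, then `F⁻¹ (incl z) = incl (ψ⁻¹ (ψ′ z))`. [folklore] -/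
theorem homeomorph_symm_apply_incl (F : W ≃ₜ W)
    (hF : ∀ z, F (b.incl z) = b.incl (ψ'.symm (ψ z))) (z : b.carrier) :
    F.symm (b.incl z) = b.incl (ψ.symm (ψ' z)) := by
  rw [Homeomorph.symm_apply_eq, hF, Diffeomorph.apply_symm_apply, Diffeomorph.symm_apply_apply]

/-- **`F ∪ id_X` is a homeomorphism `W ∪_ψ X ≃ₜ W ∪_{ψ′} X`.** Let `W` be compact, `V`, `V′`
Hausdorff, `A`, `A′` attachments of the cobordism `X` to `W` along `ψ`, `ψ′ : ∂W ≅ M`, and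
`F` a self-homeomorphism of `W` with `F (incl z) = incl (ψ′⁻¹ (ψ z))` on `∂W`. Then there is a
homeomorphism `Φ : V ≃ₜ V′` with `Φ (jW w) = jW′ (F w)` and `Φ (jX x) = jX′ x`: the maps
`F ∪ id_X` and `F⁻¹ ∪ id_X` (`exists_map_apply_jW_eq`) are mutually inverse and continuous
(`continuous_of_comp`). [cite: MilnorHCobordism1965, §1, Thm. 1.4] -/
theorem exists_homeomorph_apply_jW_eq [CompactSpace W] [T2Space V] [T2Space V']
    (A : CobordismAttachment b X ψ V) (A' : CobordismAttachment b X ψ' V') (F : W ≃ₜ W)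
    (hF : ∀ z, F (b.incl z) = b.incl (ψ'.symm (ψ z))) :
    ∃ Φ : V ≃ₜ V', (∀ w, Φ (A.jW w) = A'.jW (F w)) ∧ ∀ x, Φ (A.jX x) = A'.jX x := by
  obtain ⟨Φ, hΦW, hΦX⟩ := A.exists_map_apply_jW_eq A' F hF
  obtain ⟨Φ', hΦ'W, hΦ'X⟩ :=
    A'.exists_map_apply_jW_eq A F.symm (homeomorph_symm_apply_incl F hF)
  have h1 : ∀ p, Φ' (Φ p) = p := fun p => by
    rcases A.exists_jW_eq_or p with ⟨w, rfl⟩ | ⟨x, rfl⟩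
    · rw [hΦW, hΦ'W, Homeomorph.symm_apply_apply]
    · rw [hΦX, hΦ'X]
  have h2 : ∀ p, Φ (Φ' p) = p := fun p => by
    rcases A'.exists_jW_eq_or p with ⟨w, rfl⟩ | ⟨x, rfl⟩
    · rw [hΦ'W, hΦW, Homeomorph.apply_symm_apply]
    · rw [hΦ'X, hΦX]
  have hc : Continuous Φ := by
    refine A.continuous_of_comp ?_ ?_
    · have : Φ ∘ A.jW = A'.jW ∘ F := funext fun w => hΦW w
      rw [this]
      exact A'.continuous_jW.comp F.continuous
    · have : Φ ∘ A.jX = A'.jX := funext fun x => hΦX x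
      rw [this]
      exact A'.continuous_jX
  have hc' : Continuous Φ' := by
    refine A'.continuous_of_comp ?_ ?_
    · have : Φ' ∘ A'.jW = A.jW ∘ F.symm := funext fun w => hΦ'W w
      rw [this]
      exact A.continuous_jW.comp F.symm.continuous
    · have : Φ' ∘ A'.jX = A.jX := funext fun x => hΦ'X x
      rw [this]
      exact A.continuous_jX
  exact ⟨{ toFun := Φ, invFun := Φ', left_inv := h1, right_inv := h2,
           continuous_toFun := hc, continuous_invFun := hc' }, hΦW, hΦX⟩

/-- **The case of a twist: `W ∪_f X ≃ₜ W ∪_{id} X` when `f` extends to a self-homeomorphism of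
`W`.** For a cobordism `X` out of `∂W` itself, attachments `A` of `X` along the identity of `∂W`
(`V = W ∪_{id} X`) and `A′` along a self-diffeomorphism `f` of `∂W` (`V′ = W ∪_f X`), and a
self-homeomorphism `F` of `W` extending `f` (`F (incl z) = incl (f z)`), there is a
homeomorphism `Φ : V′ ≃ₜ V` with `Φ (jW′ w) = jW (F w)` and `Φ (jX′ x) = jX x`. This is the
situation of Akbulut–Ruberman's `V`, `V′` built from a cork `(W, f)` (loc. cit. §2: "Cutting out
the embedded copy of `W` in `V` and regluing via `f` results in a manifold `V′`"), whose `f`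
extends to a homeomorphism of `W` by the definition of a cork.
[cite: AkbulutRuberman2016, §2 (paragraph after Lemma 2.3)] -/
theorem exists_homeomorph_of_apply_incl_eq [CompactSpace W] [T2Space V] [T2Space V']
    {X : Cobordism n b.carrier N} {f : b.carrier ≃ₘ⟮𝓡 n, 𝓡 n⟯ b.carrier}
    (A : CobordismAttachment b X (Diffeomorph.refl (𝓡 n) b.carrier ∞) V)
    (A' : CobordismAttachment b X f V') (F : W ≃ₜ W)
    (hF : ∀ z, F (b.incl z) = b.incl (f z)) :
    ∃ Φ : V' ≃ₜ V, (∀ w, Φ (A'.jW w) = A.jW (F w)) ∧ ∀ x, Φ (A'.jX x) = A.jX x :=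
  A'.exists_homeomorph_apply_jW_eq A F fun z => by rw [hF, Diffeomorph.symm_refl]; rfl

end CobordismAttachment

end Literature.Topology.FourManifolds

end
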